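import Literature.AnabelianGeometry.EtaleTheta.SettingModelTateSemidirect
import Literature.AnabelianGeometry.EtaleTheta.SettingModelChiDoubleUnderline
import HarnessLib

/-!
# The Tate shear DESCENDS to the Heisenberg level `Heis(ℤ/N)` for ODD `N`
# (R78 cluster, stage 2 — level shadow of the affine action; prelude of hand #2′q)

Mochizuki, *The étale theta function …*, Publ. RIMS **45** (2009) [EtTh], §1, PRIMS PDF pp. 12–13
[cite: MochizukiEtTh2009, §1 p.13]: "`Δ^Θ_X := Δ_X/[Δ_X,[Δ_X,Δ_X]]`", "`G_{K_N}` acts trivially on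
`(Δ^tp_X)^ell/N·(Δ^tp_Y)^ell`".  abc-iut cell, layer L2, prover abc-iut-L2-d1 (gen 5), R78 cluster STAGE 2 (integrator
abc-iut-L6-d6, R78-MAP #5) over abc-iut-L2-t6's `shear`/`innB`/`affTwist₃` (`SettingModelChiShear`,
`SettingModelChiShearInner`), abc-iut-w5-d024's `twist`/`hHat_twist`/`bPow`/`hHat_bPow` (`SettingModelChiTwist`),
abc-iut-w5-d249's F4q `actχq` (`SettingModelTateSemidirect`) and this seat's `dUU` (`SettingModelChiDoubleUnderline`).

abc-iut-L6-d6's KERNEL WARNING (R78-MAP #5): the Tate shear `a ↦ a·b^k`, `b ↦ b` does NOT descend to an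
endomorphism of `Heis(ℤ/N)` when `N` is EVEN and `k` is odd (`a^N ∈ Ker ĥ_N` but `ĥ_N((ab^k)^N) = (0,0,N(N−1)k/2) ≠ 1`),
so the stage-2 tower only records the level laws (h1) (degree `0`) and (h2) (congruence set).  THIS FILE proves the
positive complement: **for ODD `N` the shear descends**, explicitly.  With `e = ½ ∈ ℤ/N`:
* `Heis.levelShear e K he : Heis R →* Heis R`, `(x, y, z) ↦ (x, y + K·x, z + K·e·(x² + x))` — a homomorphism BECAUSE
  `2e = 1` absorbs the Heisenberg cross term (`levelShear_apply`);
* **`hHat_shear_of_two_mul_eq_one`** — `ĥ_N(shear k x) = levelShear ½ (k mod N) (ĥ_N x)` for EVERY `x ∈ F̂₂` (two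
  continuous homomorphisms `F̂₂ → Heis(ℤ/N)` agreeing on `η a ↦ (1, k, k)` and `η b ↦ (0, 1, 0)`);
* **`levelHom_actχq_of_two_mul_eq_one`** — at odd level the whole stage-2 action `σ ↦ Inn(b^{κ^i}) ∘ shear(κ^j) ∘ θ_χ`
  has an honest level shadow `tateLevelHom`: `ĥ_N(pr₁(σ·γ)) = tateLevelHom N e he σ (ĥ_N(pr₁ γ))` on ALL of `Γ`;
* `exists_two_mul_eq_one_of_odd` (`½ ∈ ℤ/N` for odd `N`) and the application the choice `X̲̲` needs:
  **`actχq_mem_dUU`** — for odd `l` the subgroup `dUU l = {x_l = 0, z_l = 0} ≤ Γ` is STABLE under the stage-2 action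
  (`tateLevelHom` maps `(0, y, 0) ↦ (0, χ_l·y, 0)`).
Pure group theory of the model; consistency evidence only; nothing of [EtTh] asserted; no side taken on [IUTchIII]
Cor. 3.12.
-/

noncomputable section

namespace Literature.AnabelianGeometry.EtaleTheta.SettingModel

open Literature.AnabelianGeometry.SemiGraphs _root_.Function

/-! ### The level shear on `Heis R` (for a half `e`, `2e = 1`) -/

/-- **The level shear** `S_K : (x, y, z) ↦ (x, y + K·x, z + K·e·(x² + x))` of `Heis R`, for `e ∈ R` with `2e = 1`: the
shadow of `a ↦ a·b^K`, `b ↦ b` (`K·(x²+x)/2 = K·(1 + 2 + ⋯ + x)` counts the `b^K`'s moved past the `a`'s).  A group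
homomorphism since `2e = 1`. [cite: MochizukiEtTh2009, §1 p.13] -/
def Heis.levelShear {R : Type*} [CommRing R] (e K : R) (he : 2 * e = 1) : Heis R →* Heis R where
  toFun h := ⟨h.x, h.y + K * h.x, h.z + K * e * (h.x * h.x + h.x)⟩
  map_one' := by ext <;> simp
  map_mul' a b := by
    ext
    · simp
    · simp only [Heis.mul_x, Heis.mul_y]; ring
    · simp only [Heis.mul_x, Heis.mul_z]
      linear_combination (K * a.x * b.x) * he

/-- [cite: MochizukiEtTh2009, §1 p.13] -/
@[simp] theorem Heis.levelShear_apply {R : Type*} [CommRing R] (e K : R) (he : 2 * e = 1) (h : Heis R) :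
    Heis.levelShear e K he h = ⟨h.x, h.y + K * h.x, h.z + K * e * (h.x * h.x + h.x)⟩ := rfl

/-- `½ ∈ ℤ/N` exists for odd `N`. [cite: MochizukiEtTh2009, §1 p.13] -/
theorem exists_two_mul_eq_one_of_odd (N : ℕ+) (hN : Odd (N : ℕ)) : ∃ e : ZMod N, 2 * e = 1 :=
  ⟨((2 : ℕ) : ZMod N)⁻¹, by
    have h := ZMod.coe_mul_inv_eq_one 2 hN.coprime_two_left
    rwa [Nat.cast_ofNat] at h⟩

/-! ### The shear descends at odd level -/

/-- **`ĥ_N ∘ shear k = levelShear ½ (k mod N) ∘ ĥ_N` on ALL of `F̂₂`** whenever `2` is invertible mod `N` (odd `N`):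
the shear `a ↦ a·b^k`, `b ↦ b` HAS a level-`N` shadow.  Both sides are continuous homomorphisms `F̂₂ → Heis(ℤ/N)` and
agree on `η a ↦ (1, k, k)` (`ĥ_N(η a · b^k) = (1,0,0)·(0,k,0)`) and `η b ↦ (0,1,0)`. [cite: MochizukiEtTh2009, §1 p.13] -/
theorem hHat_shear_of_two_mul_eq_one (N : ℕ+) {e : ZMod N} (he : 2 * e = 1) (k : ZH) (x : F₂hatT) :
    hHat N (shear k x) =
      Heis.levelShear e (Multiplicative.toAdd (ZHatLevel.level N k)) he (hHat N x) := by
  let L : Heis (ZMod N) →ₜ* Heis (ZMod N) :=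
    ⟨Heis.levelShear e (Multiplicative.toAdd (ZHatLevel.level N k)) he, continuous_of_discreteTopology⟩
  have h : (hHat N).comp (shearEnd k) = L.comp (hHat N) := by
    refine ext_of_eta ?_ ?_
    · change hHat N (shearEnd k (eta (FreeGroup.of 0))) =
        Heis.levelShear e (Multiplicative.toAdd (ZHatLevel.level N k)) he (hHat N (eta (FreeGroup.of 0)))
      rw [shearEnd_eta_of_zero, map_mul, hHat_bPow, hHat_eta, heisHom_of_zero, Heis.levelShear_apply]
      ext
      · simp
      · simp
      · simp only [Heis.map_apply, Heis.mul_z, map_one, map_zero, one_mul, zero_add, mul_one, add_zero]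
        linear_combination (-(Multiplicative.toAdd (ZHatLevel.level N k))) * he
    · change hHat N (shearEnd k (eta (FreeGroup.of 1))) =
        Heis.levelShear e (Multiplicative.toAdd (ZHatLevel.level N k)) he (hHat N (eta (FreeGroup.of 1)))
      rw [shearEnd_eta_of_one, hHat_eta, heisHom_of_one, Heis.levelShear_apply]
      ext <;> simp
  exact DFunLike.congr_fun h x

/-- Specialisation at odd `N` with `e := ½`. [cite: MochizukiEtTh2009, §1 p.13] -/
theorem exists_levelShear_hHat_shear_of_odd (N : ℕ+) (hN : Odd (N : ℕ)) (k : ZH) :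
    ∃ (e : ZMod N) (he : 2 * e = 1), ∀ x : F₂hatT,
      hHat N (shear k x) = Heis.levelShear e (Multiplicative.toAdd (ZHatLevel.level N k)) he (hHat N x) := by
  obtain ⟨e, he⟩ := exists_two_mul_eq_one_of_odd N hN
  exact ⟨e, he, hHat_shear_of_two_mul_eq_one N he k⟩

/-! ### The level shadow of the whole stage-2 action at odd level -/

variable (p : ℕ) [Fact p.Prime] (i j : ℤ)

/-- **The level-`N` shadow of `σ ↦ Inn(b^{κ_p(σ)^i}) ∘ shear(κ_p(σ)^j) ∘ θ_{χ(σ)}`** (odd `N`, `2e = 1`):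
conjugation by `ĥ_N(b^{κ^i}) = (0, κ^i mod N, 0)` after `levelShear e (κ^j mod N)` after `diagTwist (χ_N σ)`.
[cite: MochizukiEtTh2009, §1 p.13] -/
def tateLevelHom (N : ℕ+) (e : ZMod N) (he : 2 * e = 1) (σ : GQp p) : Heis (ZMod N) →* Heis (ZMod N) :=
  (MulAut.conj (hHat N (bPow (kappaP p σ ^ i)))).toMonoidHom.comp
    ((Heis.levelShear e (Multiplicative.toAdd (ZHatLevel.level N (kappaP p σ ^ j))) he).comp
      (Heis.diagTwist (ZHatLevel.levelChar N (chi p σ))))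

/-- [cite: MochizukiEtTh2009, §1 p.13] -/
theorem tateLevelHom_apply (N : ℕ+) (e : ZMod N) (he : 2 * e = 1) (σ : GQp p) (h : Heis (ZMod N)) :
    tateLevelHom p i j N e he σ h =
      hHat N (bPow (kappaP p σ ^ i)) *
        Heis.levelShear e (Multiplicative.toAdd (ZHatLevel.level N (kappaP p σ ^ j))) he
          (Heis.diagTwist (ZHatLevel.levelChar N (chi p σ)) h) * (hHat N (bPow (kappaP p σ ^ i)))⁻¹ := rfl

/-- **At odd level the stage-2 action HAS an honest level law on all of `Γ`**:
`ĥ_N(pr₁(σ·γ)) = tateLevelHom N e he σ (ĥ_N(pr₁ γ))` (`2e = 1`; for even `N` no such law exists, cf. (h1)/(h2) of F4q).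
[cite: MochizukiEtTh2009, §1 p.13] -/
theorem levelHom_actχq_of_two_mul_eq_one (N : ℕ+) {e : ZMod N} (he : 2 * e = 1) (σ : GQp p) (γ : Gfp) :
    levelHom N (actχq p i j σ γ) = tateLevelHom p i j N e he σ (levelHom N γ) := by
  change hHat N (gfpFst (actχq p i j σ γ)) = tateLevelHom p i j N e he σ (hHat N (gfpFst γ))
  rw [gfpFst_actχq, actHatχq_apply, affTwist₃_apply, hHat_innB, hHat_shear_of_two_mul_eq_one N he, hHat_twist,
    tateLevelHom_apply]

/-- The same on `F̂₂`. [cite: MochizukiEtTh2009, §1 p.13] -/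
theorem hHat_actHatχq_of_two_mul_eq_one (N : ℕ+) {e : ZMod N} (he : 2 * e = 1) (σ : GQp p) (x : F₂hatT) :
    hHat N (actHatχq p i j σ x) = tateLevelHom p i j N e he σ (hHat N x) := by
  rw [actHatχq_apply, affTwist₃_apply, hHat_innB, hHat_shear_of_two_mul_eq_one N he, hHat_twist, tateLevelHom_apply]

/-- **`tateLevelHom` maps `(0, y, 0) ↦ (0, χ_N σ · y, 0)`**: on the `y`-axis the inner part, the shear and the twist
act like the diagonal twist alone. [cite: MochizukiEtTh2009, §1 p.13] -/
theorem tateLevelHom_apply_of_x_eq_zero_of_z_eq_zero (N : ℕ+) (e : ZMod N) (he : 2 * e = 1) (σ : GQp p)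
    {h : Heis (ZMod N)} (hx : h.x = 0) (hz : h.z = 0) :
    tateLevelHom p i j N e he σ h = ⟨0, ZHatLevel.levelChar N (chi p σ) * h.y, 0⟩ := by
  rw [tateLevelHom_apply, hHat_bPow]
  ext <;> simp [hx, hz]

/-! ### Application: `dUU l` is stable under the stage-2 action for odd `l` -/

/-- **For ODD `l`, `dUU l = {γ ∈ Γ | ĥ_l(pr₁ γ) has x = 0 and z = 0}` is stable under the stage-2 action `actχq p i j`**
(every `i`, `j`): the geometric part of the choice `X̲̲` of Def. 2.5 (i) survives the Tate shear precisely because `l` is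
odd ([IUTchI] Rmk. 3.1.6). [cite: MochizukiEtTh2009, Def 2.5 (i) p.39] -/
theorem actχq_mem_dUU (l : ℕ+) (hl : Odd (l : ℕ)) (σ : GQp p) ⦃γ : Gfp⦄ (hγ : γ ∈ dUU l) :
    actχq p i j σ γ ∈ dUU l := by
  obtain ⟨e, he⟩ := exists_two_mul_eq_one_of_odd l hl
  obtain ⟨hx, hz⟩ := hγ
  rw [mem_dUU_iff, levelHom_actχq_of_two_mul_eq_one p i j l he,
    tateLevelHom_apply_of_x_eq_zero_of_z_eq_zero p i j l e he σ hx hz]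
  exact ⟨rfl, rfl⟩

end Literature.AnabelianGeometry.EtaleTheta.SettingModel

end
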